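import Summits.ResolutionOfSingularities.ResolutionOfSingularities.Theorems.FrobeniusClosingPatchingRelPerfectConeDepthLineCharts
import HarnessLib

/-!
# Crux `PatchingRelPerfect` (stmt-ResolutionOfSingularities-16161), chain W5.2 — rung «r-binary-disc-ℓ», local algebra II: the charts
# `i ∈ {1, 2}` of the blowing up of the bad line of the binary form `c₁² + b c₁c₂ + a c₂²` (`b² − 4a` a unit)

[OURS · L1 W5.2 · rung tool] Replaces the role of NO printed item; NOT a statement of the manuscript under review; fact-free,
any characteristic, any residue field.  AI-written (AI review is weaker than expert review).

Continuation of `…ConeDepthLineCharts`: on the charts `i = 1, 2` the host reads `f₁ = 1 + b e₂ + a e₂²`, `f₂ = e₁² + b e₁ + a`, a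
SEPARABLE polynomial in one chart variable (unit discriminant), and the old carrier is `e₀ = c₀/c_i`.  PROVED: `lineChart_of_shape`
(worker), `lineChart_one`, `lineChart_two` — at every prime over `𝔪` the members of `{φ c_i, e₀, f_i}` lying in it are part of one
regular system of parameters of the local ring (Jacobian over `R/(c)` via `isRsopPart_lineKill`, `e₀` killed when present).

## References
* H. Matsumura, *Commutative Ring Theory*, CUP 1986, Thm. 14.2, Thm. 30.3. [Matsumura1987]
* The Stacks Project, Tags 0804, 0BIQ. [StacksProject]
-/

set_option linter.dupNamespace false

noncomputable section

open IsLocalRing Literature.AlgebraicGeometry.Resolution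
open scoped Pointwise

namespace Summit.ResolutionOfSingularities.ResolutionOfSingularities.Theorems

universe u

namespace ConeDepth

section LineChartNeZero

variable {R : Type u} [CommRing R] [IsRegularLocalRing R] (c : Fin 3 → R) {l : ℕ} (w : Fin l → R)
  (hz : Ideal.span (Set.range (Fin.append c w)) = maximalIdeal R) (hd : (maximalIdeal R).spanFinrank = 3 + l)
  (a b : R) (i : Fin 3)
  (𝔓 : Ideal (chartRing c i)) [𝔓.IsPrime] (h𝔓 : 𝔓.comap (chartBase c i) = maximalIdeal R)
  (L : Type u) [CommRing L] [IsLocalRing L] [Algebra (chartRing c i) L] [IsLocalization.AtPrime L 𝔓]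

include hz hd h𝔓 in
/-- **Worker for charts `i ≠ 0`**: if the host chart function `f` is, in terms of the other index `s ∉ {0, i}`, either
`1 + b e_s + a e_s²` with `f ∈ 𝔓 → b + 2a e_s ∉ 𝔓`, or `e_s² + b e_s + a` with `f ∈ 𝔓 → 2e_s + b ∉ 𝔓` (written without
numerals of the chart ring), then the members of
`{φ c_i, e₀, f}` in `𝔓` are part of one regular system of parameters of `L`. [cite: Matsumura1987, Thm. 30.3] -/
theorem lineChart_of_shape (hi0 : i ≠ 0) (f : chartRing c i) (s : Fin 3) (hsi : s ≠ i) (hs0 : s ≠ 0)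
    (hshape : (f = 1 + chartBase c i b * chartGen c i s + chartBase c i a * (chartGen c i s * chartGen c i s) ∧
        (f ∈ 𝔓 → chartBase c i b + (chartBase c i a * chartGen c i s + chartBase c i a * chartGen c i s) ∉ 𝔓)) ∨
      (f = chartGen c i s * chartGen c i s + chartBase c i b * chartGen c i s + chartBase c i a ∧
        (f ∈ 𝔓 → chartGen c i s + chartGen c i s + chartBase c i b ∉ 𝔓))) :
    ∃ (m : ℕ) (v : Fin m → L)
      (ι : {g : chartRing c i // g ∈ [chartBase c i (c i), chartGen c i 0, f] ∧ g ∈ 𝔓} → Fin m),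
      IsRsopPart v ∧ Function.Injective ι ∧ ∀ g, v (ι g) = (algebraMap (chartRing c i) L : chartRing c i →+* L) g.1 := by
  classical
  haveI : Nontrivial (R ⧸ Ideal.span (Set.range c)) :=
    (isRegularLocalRing_quot_centre c w hz hd).toIsLocalRing.toNontrivial
  have hε := chartQuotEquiv_apply c i (isQuasiRegular_centre c w hz hd)
  by_cases hf : f ∈ 𝔓
  · -- the kill family for `l ⊆ {0}`
    have key : ∀ (l : List {j : Fin 3 // j ≠ i}), l.Nodup → (∀ j ∈ l, j.1 = 0) → (∀ j ∈ l, chartGen c i j.1 ∈ 𝔓) →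
        IsRsopPart (consFamily c i L (chartBase c i) (killFamily i (chartGen c i) l f)) := by
      intro l hl hl0 hlu
      let σ := {j : {j : Fin 3 // j ≠ i} // j ∉ {j : {j : Fin 3 // j ≠ i} | j ∈ l}}
      let ts : σ := ⟨⟨s, hsi⟩, fun h => hs0 (hl0 _ h)⟩
      let abar : R ⧸ Ideal.span (Set.range c) := Ideal.Quotient.mk _ a
      let bbar : R ⧸ Ideal.span (Set.range c) := Ideal.Quotient.mk _ b
      rcases hshape with ⟨hfs, hder⟩ | ⟨hfs, hder⟩
      · let F : MvPolynomial σ (R ⧸ Ideal.span (Set.range c)) :=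
          1 + MvPolynomial.C bbar * MvPolynomial.X ts + MvPolynomial.C abar * (MvPolynomial.X ts * MvPolynomial.X ts)
        have hfF : chartQuotEquiv c i (isQuasiRegular_centre c w hz hd) (MvPolynomial.rename Subtype.val F) =
            Ideal.Quotient.mk _ f := by
          rw [hfs]
          simp only [F, map_add, map_mul, map_one, MvPolynomial.rename_X, MvPolynomial.rename_C, hε, chartQuotMap_X,
            chartQuotMap_C, ts, abar, bbar]
        have hF0 : F ≠ 0 := by
          intro h
          have h' := congrArg (MvPolynomial.eval (fun _ : σ => (0 : R ⧸ Ideal.span (Set.range c)))) h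
          simp only [F, map_add, map_mul, map_one, MvPolynomial.eval_X, MvPolynomial.eval_C, mul_zero, add_zero,
            map_zero] at h'
          exact one_ne_zero h'
        have hGa : chartQuotEquiv c i (isQuasiRegular_centre c w hz hd)
            (MvPolynomial.rename Subtype.val (MvPolynomial.pderiv ts F)) =
            Ideal.Quotient.mk _ (chartBase c i b + (chartBase c i a * chartGen c i s + chartBase c i a * chartGen c i s)) := by
          have hp : MvPolynomial.pderiv ts F = MvPolynomial.C bbar + 2 * MvPolynomial.C abar * MvPolynomial.X ts := by
            simp only [F, map_add, Derivation.leibniz, MvPolynomial.pderiv_X_self, MvPolynomial.pderiv_C,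
              smul_eq_mul, mul_one, Derivation.map_one_eq_zero, zero_add]
            ring
          rw [hp]
          simp only [map_add, map_mul, map_ofNat, MvPolynomial.rename_X, MvPolynomial.rename_C, hε, chartQuotMap_X,
            chartQuotMap_C, ts, abar, bbar]
          ring
        exact isRsopPart_lineKill c w hz hd i 𝔓 h𝔓 L l hl hlu f hf F hF0 hfF ts _ hGa (hder hf)
      · let F : MvPolynomial σ (R ⧸ Ideal.span (Set.range c)) :=
          MvPolynomial.X ts * MvPolynomial.X ts + MvPolynomial.C bbar * MvPolynomial.X ts + MvPolynomial.C abar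
        have hfF : chartQuotEquiv c i (isQuasiRegular_centre c w hz hd) (MvPolynomial.rename Subtype.val F) =
            Ideal.Quotient.mk _ f := by
          rw [hfs]
          simp only [F, map_add, map_mul, MvPolynomial.rename_X, MvPolynomial.rename_C, hε, chartQuotMap_X, chartQuotMap_C,
            ts, abar, bbar]
        have hp : MvPolynomial.pderiv ts F = 2 * MvPolynomial.X ts + MvPolynomial.C bbar := by
          simp only [F, map_add, Derivation.leibniz, MvPolynomial.pderiv_X_self, MvPolynomial.pderiv_C, smul_eq_mul,
            mul_one, add_zero]
          ring
        have hF0 : F ≠ 0 := by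
          intro h
          have h' := congrArg (fun G => Polynomial.coeff
            (MvPolynomial.eval₂ (Polynomial.C : R ⧸ Ideal.span (Set.range c) →+* Polynomial (R ⧸ Ideal.span (Set.range c)))
              (fun _ : σ => Polynomial.X) G) 2) h
          simp only [F, MvPolynomial.eval₂_add, MvPolynomial.eval₂_mul, MvPolynomial.eval₂_X, MvPolynomial.eval₂_C,
            MvPolynomial.eval₂_zero, Polynomial.coeff_zero, Polynomial.coeff_add, Polynomial.coeff_C_mul,
            Polynomial.coeff_X_mul, Polynomial.coeff_X, Polynomial.coeff_C] at h'
          norm_num at h'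
        have hGa : chartQuotEquiv c i (isQuasiRegular_centre c w hz hd)
            (MvPolynomial.rename Subtype.val (MvPolynomial.pderiv ts F)) =
            Ideal.Quotient.mk _ (chartGen c i s + chartGen c i s + chartBase c i b) := by
          rw [hp]
          simp only [map_add, map_mul, map_ofNat, MvPolynomial.rename_X, MvPolynomial.rename_C, hε, chartQuotMap_X,
            chartQuotMap_C, ts, bbar]
          ring
        exact isRsopPart_lineKill c w hz hd i 𝔓 h𝔓 L l hl hlu f hf F hF0 hfF ts _ hGa (hder hf)
    by_cases h0 : chartGen c i 0 ∈ 𝔓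
    · have hrs := key [⟨0, hi0.symm⟩] (List.nodup_singleton _) (by simp) (by simpa using h0)
      exact rsopAdapted_of_consFamily_killFamily₃ c i 𝔓 L _ f hrs _ (fun g hg _ => by
        simp only [List.mem_cons, List.not_mem_nil, or_false] at hg
        rcases hg with rfl | rfl | rfl
        · exact Or.inl rfl
        · exact Or.inr (Or.inl ⟨⟨0, hi0.symm⟩, List.mem_singleton_self _, rfl⟩)
        · exact Or.inr (Or.inr rfl))
    · have hrs := key [] List.nodup_nil (by simp) (by simp)
      exact rsopAdapted_of_consFamily_killFamily₃ c i 𝔓 L _ f hrs _ (fun g hg hgP => by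
        simp only [List.mem_cons, List.not_mem_nil, or_false] at hg
        rcases hg with rfl | rfl | rfl
        · exact Or.inl rfl
        · exact absurd hgP h0
        · exact Or.inr (Or.inr rfl))
  · by_cases h0 : chartGen c i 0 ∈ 𝔓
    · have hrs := isRsopPart_lineChartFamily c w hz hd i 𝔓 h𝔓 L (m := 1) (fun _ => ⟨0, hi0.symm⟩)
        (Function.injective_of_subsingleton _) (fun _ => h0)
      exact rsopAdapted_of_lineChartFamily c w i 𝔓 L _ hrs _ (fun g hg hgP => by
        simp only [List.mem_cons, List.not_mem_nil, or_false] at hg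
        rcases hg with rfl | rfl | rfl
        · exact Or.inl rfl
        · exact Or.inr ⟨0, rfl⟩
        · exact absurd hgP hf)
    · have hrs := isRsopPart_lineChartFamily c w hz hd i 𝔓 h𝔓 L (m := 0) (fun k => k.elim0)
        (Function.injective_of_subsingleton _) (fun k => k.elim0)
      exact rsopAdapted_of_lineChartFamily c w i 𝔓 L _ hrs _ (fun g hg hgP => by
        simp only [List.mem_cons, List.not_mem_nil, or_false] at hg
        rcases hg with rfl | rfl | rfl
        · exact Or.inl rfl
        · exact absurd hgP h0
        · exact absurd hgP hf)

end LineChartNeZero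

section LineChartOneTwo

variable {R : Type u} [CommRing R] [IsRegularLocalRing R] (c : Fin 3 → R) {l : ℕ} (w : Fin l → R)
  (hz : Ideal.span (Set.range (Fin.append c w)) = maximalIdeal R) (hd : (maximalIdeal R).spanFinrank = 3 + l)
  (a b : R) (hD : IsUnit (b ^ 2 - 4 * a))

include hz hd hD in
/-- **Chart `1`**: `f₁ = 1 + b e₂ + a e₂²`; the members of `{φ c₁, e₀, f₁}` in `𝔓` are part of one regular system of parameters.
[cite: Matsumura1987, Thm. 30.3] -/
theorem lineChart_one (𝔓 : Ideal (chartRing c 1)) [𝔓.IsPrime] (h𝔓 : 𝔓.comap (chartBase c 1) = maximalIdeal R)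
    (L : Type u) [CommRing L] [IsLocalRing L] [Algebra (chartRing c 1) L] [IsLocalization.AtPrime L 𝔓] :
    ∃ (m : ℕ) (v : Fin m → L)
      (ι : {g : chartRing c 1 // g ∈ [chartBase c 1 (c 1), chartGen c 1 0,
        chartGen c 1 1 * chartGen c 1 1 + chartBase c 1 b * (chartGen c 1 1 * chartGen c 1 2) +
          chartBase c 1 a * (chartGen c 1 2 * chartGen c 1 2)] ∧ g ∈ 𝔓} → Fin m),
      IsRsopPart v ∧ Function.Injective ι ∧ ∀ g, v (ι g) = (algebraMap (chartRing c 1) L : chartRing c 1 →+* L) g.1 := by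
  have hDφ : IsUnit (chartBase c 1 b ^ 2 - 4 * chartBase c 1 a) := by
    have := hD.map (chartBase c 1); rwa [map_sub, map_pow, map_mul, map_ofNat] at this
  have h11 : chartGen c 1 1 = 1 := chartGen_self c 1
  have hfs : chartGen c 1 1 * chartGen c 1 1 + chartBase c 1 b * (chartGen c 1 1 * chartGen c 1 2) +
      chartBase c 1 a * (chartGen c 1 2 * chartGen c 1 2) =
      1 + chartBase c 1 b * chartGen c 1 2 + chartBase c 1 a * (chartGen c 1 2 * chartGen c 1 2) := by
    rw [h11]; ring
  refine lineChart_of_shape c w hz hd a b 1 𝔓 h𝔓 L (by decide) _ 2 (by decide) (by decide) (Or.inl ⟨hfs, fun hf => ?_⟩)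
  rw [hfs] at hf
  exact (partial_notMem_of_disc_unit 𝔓 (chartBase c 1 a) (chartBase c 1 b) (chartGen c 1 2) hDφ).1 hf

include hz hd hD in
/-- **Chart `2`**: `f₂ = e₁² + b e₁ + a`; the members of `{φ c₂, e₀, f₂}` in `𝔓` are part of one regular system of parameters.
[cite: Matsumura1987, Thm. 30.3] -/
theorem lineChart_two (𝔓 : Ideal (chartRing c 2)) [𝔓.IsPrime] (h𝔓 : 𝔓.comap (chartBase c 2) = maximalIdeal R)
    (L : Type u) [CommRing L] [IsLocalRing L] [Algebra (chartRing c 2) L] [IsLocalization.AtPrime L 𝔓] :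
    ∃ (m : ℕ) (v : Fin m → L)
      (ι : {g : chartRing c 2 // g ∈ [chartBase c 2 (c 2), chartGen c 2 0,
        chartGen c 2 1 * chartGen c 2 1 + chartBase c 2 b * (chartGen c 2 1 * chartGen c 2 2) +
          chartBase c 2 a * (chartGen c 2 2 * chartGen c 2 2)] ∧ g ∈ 𝔓} → Fin m),
      IsRsopPart v ∧ Function.Injective ι ∧ ∀ g, v (ι g) = (algebraMap (chartRing c 2) L : chartRing c 2 →+* L) g.1 := by
  have hDφ : IsUnit (chartBase c 2 b ^ 2 - 4 * chartBase c 2 a) := by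
    have := hD.map (chartBase c 2); rwa [map_sub, map_pow, map_mul, map_ofNat] at this
  have h22 : chartGen c 2 2 = 1 := chartGen_self c 2
  have hfs : chartGen c 2 1 * chartGen c 2 1 + chartBase c 2 b * (chartGen c 2 1 * chartGen c 2 2) +
      chartBase c 2 a * (chartGen c 2 2 * chartGen c 2 2) =
      chartGen c 2 1 * chartGen c 2 1 + chartBase c 2 b * chartGen c 2 1 + chartBase c 2 a := by
    rw [h22]; ring
  refine lineChart_of_shape c w hz hd a b 2 𝔓 h𝔓 L (by decide) _ 1 (by decide) (by decide) (Or.inr ⟨hfs, fun hf => ?_⟩)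
  rw [hfs] at hf
  exact (partial_notMem_of_disc_unit 𝔓 (chartBase c 2 a) (chartBase c 2 b) (chartGen c 2 1) hDφ).2 hf

end LineChartOneTwo

end ConeDepth

end Summit.ResolutionOfSingularities.ResolutionOfSingularities.Theorems

end
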